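import Summits.PneNP.PneNP.Theorems.PhaseTwinsPolyDepthTwinsAboveAcDefs
import Summits.PneNP.PneNP.Theorems.PhaseTwinsPolyDepthTwinsAboveDuplicator

/-!
# Route PhaseTwins, crux `PolyDepthTwinsAbove` (stmt-PneNP-2719), line `annealed-cover-twins`: stub `stub_duplicator`

Duplicator wins the bijective `K`-pebble game on the cover-wired CFI graphs `acGraph R P τ S c` and
`acGraph R P τ S c'` for ANY two charge vectors `c, c'` and EVERY gadget sample `S`, whenever the base `R` is an
`η`-edge-expander on `M ≥ 2` vertices and `6K < ηM`. This is the landed sibling theorem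
`ParityWiredPorts.stub_duplicator` (file `PhaseTwinsPolyDepthTwinsAboveDuplicator.lean`) mutatis mutandis — the
strategy of `CFIMatching.ckEquiv_mgraph` (Atserias–Dawar 2019, Lemma 3.2; Cai–Fürer–Immerman 1992, §6):
* the shift `pshift g` of the vertices by a dart function `g` constant on edges is an isomorphism
  `acGraph c ≅ acGraph (c + ∂g)` (`acGraph_adj_shift_iff`): both endpoints `(δ, a, x)`, `(δ, a + 1, y)` of a
  gadget edge move by the same bit `g δ` (the deck involution is an automorphism of every cover gadget; `S`, `P`,
  `τ` never move), the end `(w, i, a, j)` and its port vertex `((canonEnd R (w,i)).1, a, _)` move by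
  `g (w, i) = g ((canonEnd R (w, i)).1)` (the canonical dart of the edge is `(w, i)` or its reverse), and the
  represented bits of an inner vertex move by `CFIMatching.bit_shift`;
* the charges enter adjacency only at INNER vertices (`acGraph_adj_congr`, via the sibling's `pch`);
* the generic toolkit of the sibling file (`pshift`, `pneed`, `PNeed`, `pch_eq_of_good`, `good_mono`,
  `card_PNeed_lt`) is imported verbatim: positions on the graph of `pshift g` with `(PNeed p, g)` admissible and
  locally consistent for `c + c'` are partial isomorphisms (`isPartialIso_of_good`), the forth move extends `g` to
  the `≤ 6` needed darts of the new vertex (`extend_many`; budget `6(|p| + 1) ≤ 6K < ηM`), and Duplicator's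
  bijection shifts every vertex by the extension chosen for its own needed darts (`stub_duplicator`).
-/

noncomputable section

open scoped Classical BigOperators

namespace Summit.PneNP.PneNP.Cruxes.PolyDepthTwinsAbove.AnnealedCoverTwins

open Finset
open Summit.PneNP.PneNP.Cruxes.PolyDepthTwinsAbove.ParityWiredPorts (PWVert canonEnd pshift pshift_pshift
  pshift_involutive pch pneed rot_mem_pneed card_pneed_le mem_pneed_inner mem_pneed_copy mem_pneed_end
  pshift_congr pneed_pshift PNeed mem_PNeed PNeed_mono rot_mem_PNeed pneed_subset_PNeed PNeed_empty PNeed_insert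
  card_PNeed_le pch_eq_of_good good_mono card_PNeed_lt)
open Literature.Computability.Complexity.Expander (RotGraph)
open Literature.ModelTheory.FiniteModelTheory (CkEquiv IsPartialIso)
open Literature.ModelTheory.FiniteModelTheory.TseitinColouring (Dart EdgeExpansion bd DAdm LocCons restrictTo
  extend_many dAdm_restrict locCons_restrict constraint_of_blocked locCons_empty dAdm_empty)
open Literature.ModelTheory.FiniteModelTheory.CFIMatching (bit Canon bit_shift zmod2_add_self)

set_option linter.dupNamespace false

variable {M n' κ dm : ℕ}

/-! ### The shift is an isomorphism `acGraph c ≅ acGraph (c + ∂g)` -/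

/-- **The shift by a `g` constant on edges transports `acRel c` to `acRel (c + ∂g)`**: both endpoints of a
gadget edge move by the same bit `g δ` (and `S`, `τ` are untouched), the end `(w, i, a, j)` and its port vertex
move by `g (w, i) = g ((canonEnd R (w, i)).1)`, and the represented bits of an inner vertex transform by
`CFIMatching.bit_shift`. -/
theorem acRel_shift_iff (R : RotGraph M 3) (P : Fin 2 × Fin κ ↪ Fin n') (τ : Equiv.Perm (Fin n'))
    (S : Dart M 3 → Fin dm → Equiv.Perm (Fin n')) {g : Dart M 3 → ZMod 2} (hg : ∀ δ, g (R.rot δ) = g δ)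
    (c : Fin M → ZMod 2) (x y : PWVert M n' κ) :
    acRel R P τ S (c + bd g) (pshift g x) (pshift g y) ↔ acRel R P τ S c x y := by
  rcases x with ⟨δ, a, x⟩ | ⟨w, i, a, j⟩ | ⟨w, S₀, j⟩ <;>
    rcases y with ⟨δ', a', y⟩ | ⟨w', i', a', j'⟩ | ⟨w', S', j'⟩ <;> simp only [pshift, acRel]
  · -- gadget / gadget
    constructor
    · rintro ⟨hc, rfl, ha, hxy, hadj⟩
      refine ⟨hc, rfl, ?_, hxy, hadj⟩
      rw [add_right_comm] at ha
      exact add_right_cancel ha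
    · rintro ⟨hc, rfl, rfl, hxy, hadj⟩
      exact ⟨hc, rfl, add_right_comm _ _ _, hxy, hadj⟩
  · -- end / gadget
    have hce : g (canonEnd R (w, i)).1 = g (w, i) := by
      unfold canonEnd
      split_ifs
      · rfl
      · exact hg _
    constructor
    · rintro ⟨ha, rfl, hy⟩
      rw [hce] at ha
      exact ⟨add_right_cancel ha, rfl, hy⟩
    · rintro ⟨rfl, rfl, hy⟩
      exact ⟨by rw [hce], rfl, hy⟩
  · -- inner / end
    constructor
    · rintro ⟨rfl, hj, h⟩
      refine ⟨rfl, hj, ?_⟩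
      rw [bit_shift] at h
      exact add_right_cancel h
    · rintro ⟨rfl, hj, h⟩
      refine ⟨rfl, hj, ?_⟩
      rw [bit_shift, h]

/-- **Hence the shift is an isomorphism `acGraph c ≅ acGraph (c + ∂g)`** (for every sample `S`). -/
theorem acGraph_adj_shift_iff (R : RotGraph M 3) (P : Fin 2 × Fin κ ↪ Fin n') (τ : Equiv.Perm (Fin n'))
    (S : Dart M 3 → Fin dm → Equiv.Perm (Fin n')) {g : Dart M 3 → ZMod 2} (hg : ∀ δ, g (R.rot δ) = g δ)
    (c : Fin M → ZMod 2) (x y : PWVert M n' κ) :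
    (acGraph R P τ S (c + bd g)).Adj (pshift g x) (pshift g y) ↔ (acGraph R P τ S c).Adj x y := by
  simp only [acGraph_adj, ne_eq, (pshift_involutive g).injective.eq_iff, acRel_shift_iff R P τ S hg]

/-! ### Charges only matter at inner vertices -/

/-- Charge functions read identically at `x` and `y` (the sibling's `pch`) generate the same adjacency. -/
theorem acRel_congr (R : RotGraph M 3) (P : Fin 2 × Fin κ ↪ Fin n') (τ : Equiv.Perm (Fin n'))
    (S : Dart M 3 → Fin dm → Equiv.Perm (Fin n')) {c c' : Fin M → ZMod 2} {x y : PWVert M n' κ}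
    (hx : pch c x = pch c' x) (hy : pch c y = pch c' y) : acRel R P τ S c x y ↔ acRel R P τ S c' x y := by
  rcases x with ⟨δ, a, x⟩ | ⟨w, i, a, j⟩ | ⟨w, S₀, j⟩ <;>
    rcases y with ⟨δ', a', y⟩ | ⟨w', i', a', j'⟩ | ⟨w', S', j'⟩ <;> simp only [acRel, pch] at hx hy ⊢
  rw [hx]

/-- Charge functions read identically at `x` and `y` give the same adjacency. -/
theorem acGraph_adj_congr (R : RotGraph M 3) (P : Fin 2 × Fin κ ↪ Fin n') (τ : Equiv.Perm (Fin n'))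
    (S : Dart M 3 → Fin dm → Equiv.Perm (Fin n')) {c c' : Fin M → ZMod 2} {x y : PWVert M n' κ}
    (hx : pch c x = pch c' x) (hy : pch c y = pch c' y) :
    (acGraph R P τ S c).Adj x y ↔ (acGraph R P τ S c').Adj x y := by
  simp only [acGraph_adj, acRel_congr R P τ S hx hy, acRel_congr R P τ S hy.symm hx.symm]

/-! ### The strategy -/

/-- **Winning positions are partial isomorphisms** `acGraph c ⇀ acGraph c'`: pebble pairs on the graph of the
shift by an admissible partial assignment `g` of the needed darts, locally consistent for the charge `c + c'`
(so that `c + ∂g` and `c'` are read identically at every pebbled vertex, `pch_eq_of_good`). -/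
theorem isPartialIso_of_good {R : RotGraph M 3} (P : Fin 2 × Fin κ ↪ Fin n') (τ : Equiv.Perm (Fin n'))
    (S : Dart M 3 → Fin dm → Equiv.Perm (Fin n')) (c c' : Fin M → ZMod 2) (hM : 2 ≤ M)
    {p : Set (PWVert M n' κ × PWVert M n' κ)} {g : Dart M 3 → ZMod 2}
    (hadm : DAdm R (PNeed R p) g) (hcons : LocCons R (c + c') (PNeed R p) g)
    (hgraph : ∀ x ∈ p, x.2 = pshift g x.1) : IsPartialIso (acGraph R P τ S c) (acGraph R P τ S c') p := by
  refine ⟨fun x hx y hy => ?_, fun x hx y hy => ?_⟩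
  · rw [hgraph x hx, hgraph y hy]
    exact ((pshift_involutive g).injective.eq_iff).symm
  · rw [hgraph x hx, hgraph y hy]
    rw [← acGraph_adj_congr R P τ S (pch_eq_of_good c c' hM hcons hx) (pch_eq_of_good c c' hM hcons hy)]
    exact (acGraph_adj_shift_iff R P τ S hadm.rot_eq c x.1 y.1).symm

/-- **S5 — Duplicator wins the bijective `K`-pebble game on `acGraph R P τ S c` and `acGraph R P τ S c'`** for
any two charge vectors and every gadget sample `S`, whenever `6K < ηM` (`R` an `η`-edge-expander of degree `3` on
`M ≥ 2` vertices): the CFI gauge `pshift` plus local consistency for the charge `c + c'` (Atserias–Dawar 2019,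
Lemma 3.2; the strategy of the sibling `ParityWiredPorts.stub_duplicator` verbatim). -/
theorem stub_duplicator {R : RotGraph M 3} {η : ℝ} (hR : EdgeExpansion R η) (hM : 2 ≤ M)
    (P : Fin 2 × Fin κ ↪ Fin n') (τ : Equiv.Perm (Fin n')) (S : Dart M 3 → Fin dm → Equiv.Perm (Fin n'))
    (c c' : Fin M → ZMod 2) {K : ℕ} (hK : (2 * 3 * K : ℝ) < η * M) :
    CkEquiv K (acGraph R P τ S c) (acGraph R P τ S c') := by
  refine ⟨{ carrier := {p | p.Finite ∧ p.ncard ≤ K ∧ ∃ g, DAdm R (PNeed R p) g ∧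
              LocCons R (c + c') (PNeed R p) g ∧ ∀ x ∈ p, x.2 = pshift g x.1}
            empty_mem := ?_
            finite_of_mem := fun p hp => hp.1
            ncard_le_of_mem := fun p hp => hp.2.1
            isPartialIso_of_mem := fun p hp => ?_
            mem_of_subset := fun p hp q hqp => ?_
            forth := fun p hp hpK => ?_ }⟩
  · refine ⟨Set.finite_empty, by simp, fun _ => 0, ?_, ?_, fun x hx => (Set.notMem_empty x hx).elim⟩
    · rw [PNeed_empty]; exact dAdm_empty R
    · rw [PNeed_empty]; exact locCons_empty R hR (c + c')
  · obtain ⟨g, hadm, hcons, hgraph⟩ := hp.2.2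
    exact isPartialIso_of_good P τ S c c' hM hadm hcons hgraph
  · obtain ⟨g, hadm, hcons, hgraph⟩ := hp.2.2
    exact ⟨hp.1.subset hqp, (Set.ncard_le_ncard hqp hp.1).trans hp.2.1, _, good_mono c c' hadm hcons hgraph hqp⟩
  · obtain ⟨hpfin, -, g, hgadm, hgcons, hgraph⟩ := hp
    -- the chosen extensions, one for each set of extra darts
    have hex : ∀ z : PWVert M n' κ, ∃ g', DAdm R (PNeed R p ∪ pneed R z) g' ∧
        LocCons R (c + c') (PNeed R p ∪ pneed R z) g' ∧ ∀ δ ∈ PNeed R p, g' δ = g δ := fun z =>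
      extend_many R hR (pneed R z) (fun δ hδ => rot_mem_pneed R hδ) _ (PNeed R p) g le_rfl hgadm hgcons
        (card_PNeed_lt hR hK hpfin hpK z)
    have hexS : ∀ D : Finset (Dart M 3), (∃ z : PWVert M n' κ, pneed R z = D) →
        ∃ g', DAdm R (PNeed R p ∪ D) g' ∧ LocCons R (c + c') (PNeed R p ∪ D) g' ∧
          ∀ δ ∈ PNeed R p, g' δ = g δ := by
      rintro D ⟨z, rfl⟩; exact hex z
    set E : Finset (Dart M 3) → Dart M 3 → ZMod 2 := fun D =>
      if h : ∃ z : PWVert M n' κ, pneed R z = D then Classical.choose (hexS D h) else g with hE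
    have hEspec : ∀ z : PWVert M n' κ, DAdm R (PNeed R p ∪ pneed R z) (E (pneed R z)) ∧
        LocCons R (c + c') (PNeed R p ∪ pneed R z) (E (pneed R z)) ∧
          ∀ δ ∈ PNeed R p, E (pneed R z) δ = g δ := by
      intro z
      have h : ∃ z' : PWVert M n' κ, pneed R z' = pneed R z := ⟨z, rfl⟩
      have hEz : E (pneed R z) = Classical.choose (hexS _ h) := by simp only [hE, dif_pos h]
      rw [hEz]
      exact Classical.choose_spec (hexS _ h)
    -- Duplicator's bijection: shift each vertex by the extension chosen for its own needs
    set F : PWVert M n' κ → PWVert M n' κ := fun z => pshift (E (pneed R z)) z with hF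
    have hFinv : Function.Involutive F := by
      intro z
      show pshift (E (pneed R (pshift (E (pneed R z)) z))) (pshift (E (pneed R z)) z) = z
      rw [pneed_pshift, pshift_pshift]
    refine ⟨hFinv.toPerm F, fun a => ?_⟩
    have hFa : (hFinv.toPerm F) a = F a := rfl
    rw [hFa]
    obtain ⟨hadm, hcons, heq⟩ := hEspec a
    refine ⟨hpfin.insert _, (Set.ncard_insert_le _ _).trans (Nat.succ_le_of_lt hpK), E (pneed R a),
      ?_, ?_, ?_⟩
    · rw [PNeed_insert, Finset.union_comm]; exact hadm
    · rw [PNeed_insert, Finset.union_comm]; exact hcons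
    · rintro x (rfl | hx)
      · rfl
      · rw [hgraph x hx]
        exact pshift_congr R fun δ hδ => (heq δ (pneed_subset_PNeed R hx hδ)).symm

end Summit.PneNP.PneNP.Cruxes.PolyDepthTwinsAbove.AnnealedCoverTwins
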